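import Summits.Ventures.DiscreteObjects.PP12.OrderThirteenPlace
import Summits.Ventures.DiscreteObjects.PP12.OrderThirteenShapeCells

/-!
# PP(12), order-13 cell: SOUNDNESS of the kernel placement search (class MS[0] residue stage)
Framing: lottery ticket; floor = certified bounds/negative ranges.

Cell pub-namedobj (venture DiscreteObjects), target (M), designs gen 21 (blank lines removed by designs gen 22 for the gate's 400-line rule; text otherwise byte-identical). `Place13.placeK cells 0 0 0 0 = true` (`OrderThirteenPlace`) is a finite computation;
here we prove what it MEANS: if `D : LiftData 11 13` is VALID and every listed cell `(s, t, g)` is a nonempty cell of `D` with shape `g` (`LiftData.gsh`), the listed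
cells being pairwise distinct, then `placeK cells 0 0 0 0 = true` is impossible (`placeK_sound`, `noPlace`). The true translates `LiftData.gof` pass every test of the
search: a cell avoids `0` ((M·U)), two cells of a row are disjoint (`cell_disjoint_row`), two cells of a column are disjoint ((U·U′)), and the cross differences of a
row pair in different columns are disjoint (`crossDiff_disjoint`); the cross differences of two translates are the translate of the table entry
(`crossDiff_of_translate`, `dtab_spec`). No `sorry`, no new axioms; nothing here asserts a census statement.
-/

set_option maxRecDepth 100000

namespace Summit.Ventures.DiscreteObjects.PP12
namespace Place13
open Finset Shape13 LiftData
/-! ### the table and the fields -/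
/-- the difference table is `diffMask (shm a) (shm b)` (kernel check) -/
theorem dtab_spec_b : allLT (fun a => allLT (fun b => Nat.beq (dtab a b) (diffMask (shm a) (shm b))) 27) 27 = true := by decide +kernel
/-- the difference table entry -/
theorem dtab_spec {a b : ℕ} (ha : a < 27) (hb : b < 27) : dtab a b = diffMask (shm a) (shm b) := by
  have := allLT_iff.1 (allLT_iff.1 dtab_spec_b a ha) b hb
  rwa [Shape13.beq_eq_decide, decide_eq_true_eq] at this
/-- the bits of a 13-bit field -/
theorem testBit_fld (V i j : ℕ) : (fld V i).testBit j = (decide (j < 13) && V.testBit (13 * i + j)) := by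
  unfold fld
  rw [Shape13.land_def, Shape13.shiftRight_def, Nat.testBit_land, Nat.testBit_shiftRight, show (8191 : ℕ) = 2 ^ 13 - 1 from rfl, Nat.testBit_two_pow_sub_one, Bool.and_comm]
/-- a 13-bit field is `< 2^13` -/
theorem fld_lt (V i : ℕ) : fld V i < 2 ^ 13 := by
  refine Nat.lt_pow_two_of_testBit _ fun j hj => ?_
  rw [testBit_fld]; simp [Nat.not_lt.2 hj]
/-- the bits of a 9-bit record field -/
theorem testBit_qget (Q c j : ℕ) : (qget Q c).testBit j = (decide (j < 9) && Q.testBit (9 * c + j)) := by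
  unfold qget
  rw [Shape13.land_def, Shape13.shiftRight_def, Nat.testBit_land, Nat.testBit_shiftRight, show (511 : ℕ) = 2 ^ 9 - 1 from rfl, Nat.testBit_two_pow_sub_one, Bool.and_comm]
/-- setting bits in field `i` by `lor`: other fields unchanged, field `i` gets the `lor` (for a 13-bit value) -/
theorem testBit_fld_lor {V m i i' j : ℕ} (hm : m < 2 ^ 13) (hj : j < 13) :
    (fld (Nat.lor V (Nat.shiftLeft m (13 * i))) i').testBit j = ((fld V i').testBit j || (decide (i' = i) && m.testBit j)) := by
  rw [testBit_fld, testBit_fld, Shape13.lor_def, Shape13.shiftLeft_def, Nat.testBit_lor, Nat.testBit_shiftLeft]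
  simp only [hj, decide_true, Bool.true_and]
  by_cases h : i' = i
  · subst h; simp
  · have : (decide (13 * i' + j ≥ 13 * i) && m.testBit (13 * i' + j - 13 * i)) = false := by
      rcases Nat.lt_or_gt_of_ne h with h | h
      · have : ¬ (13 * i' + j ≥ 13 * i) := by omega
        simp [this]
      · have hb : m.testBit (13 * i' + j - 13 * i) = false := testBit_eq_false_of_lt_le (n := 13) hm (by omega)
        simp [hb]
    rw [this]; simp [h]
/-- writing an EMPTY record field by `lor`: other fields unchanged… -/
theorem qget_lor_of_ne {Q c c' v : ℕ} (hv : v < 512) (h : c' ≠ c) : qget (Nat.lor Q (Nat.shiftLeft v (9 * c))) c' = qget Q c' := by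
  apply Nat.eq_of_testBit_eq; intro j
  rw [testBit_qget, testBit_qget, Shape13.lor_def, Shape13.shiftLeft_def, Nat.testBit_lor, Nat.testBit_shiftLeft]
  by_cases hj : j < 9
  · simp only [hj, decide_true, Bool.true_and]
    have : (decide (9 * c' + j ≥ 9 * c) && v.testBit (9 * c' + j - 9 * c)) = false := by
      rcases Nat.lt_or_gt_of_ne h with h | h
      · have : ¬ (9 * c' + j ≥ 9 * c) := by omega
        simp [this]
      · have hb : v.testBit (9 * c' + j - 9 * c) = false := testBit_eq_false_of_lt_le (n := 9) hv (by omega)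
        simp [hb]
    rw [this, Bool.or_false]
  · simp [hj]
/-- … and the field itself becomes `v` -/
theorem qget_lor_self {Q c v : ℕ} (hv : v < 512) (h0 : qget Q c = 0) : qget (Nat.lor Q (Nat.shiftLeft v (9 * c))) c = v := by
  apply Nat.eq_of_testBit_eq; intro j
  rw [testBit_qget, Shape13.lor_def, Shape13.shiftLeft_def, Nat.testBit_lor, Nat.testBit_shiftLeft]
  by_cases hj : j < 9
  · have hQ : Q.testBit (9 * c + j) = false := by
      have := congrArg (fun x => Nat.testBit x j) h0
      simp only [testBit_qget, hj, decide_true, Bool.true_and, Nat.zero_testBit] at this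
      exact this
    simp [hj, hQ, show 9 * c + j - 9 * c = j by omega]
  · simp only [hj, decide_false, Bool.false_and]
    exact (testBit_eq_false_of_lt_le (n := 9) hv (by omega)).symm
/-- `land a b = 0` from bitwise disjointness -/
theorem land_eq_zero_of {a b : ℕ} (h : ∀ j, a.testBit j = true → b.testBit j = true → False) : Nat.land a b = 0 := by
  apply Nat.eq_of_testBit_eq; intro j
  rw [Shape13.land_def, Nat.testBit_land, Nat.zero_testBit]
  cases ha : a.testBit j
  · rfl
  · cases hb : b.testBit j
    · rfl
    · exact absurd (h j ha hb) id
/-! ### the true data -/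
section valid
variable (D : LiftData 11 13) (hV : D.Valid)
include hV
/-- the mask of a nonempty cell is the translate of its shape: bit reading -/
theorem testBit_cell {s t : Fin 11} (h1 : 1 ≤ D.om s t) (i : Fin 13) : (rot13 (shm (D.gsh s t)) (D.gof s t)).testBit i = D.mem s t i := by
  rw [(D.shape_spec hV h1).2.2, testBit_cmask]
/-- **the cross differences of two nonempty cells of a column are the translate of the table entry** -/
theorem maskOf_crossDiff_eq {s s' t : Fin 11} (h1 : 1 ≤ D.om s t) (h1' : 1 ≤ D.om s' t) :
    maskOf (D.crossDiff s s' t) = rot13 (dtab (D.gsh s t) (D.gsh s' t)) ((D.gof s t + 13 - D.gof s' t) % 13) := by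
  obtain ⟨hg, hx, -⟩ := D.shape_spec hV h1
  obtain ⟨hg', hx', -⟩ := D.shape_spec hV h1'
  rw [D.crossDiff_of_translate (D.cell_eq_image hV h1) (D.cell_eq_image hV h1'), maskOf_image_add, maskOf_image₂_sub,
    maskOf_setOf (shm_facts hg).1, maskOf_setOf (shm_facts hg').1, dtab_spec hg hg']
  congr 1
  rw [Fin.sub_def]
  dsimp only
  omega
/-- membership in the cross differences, read as a bit of the mask -/
theorem mem_crossDiff_iff_testBit {s s' t : Fin 11} (h1 : 1 ≤ D.om s t) (h1' : 1 ≤ D.om s' t) (i : Fin 13) :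
    i ∈ D.crossDiff s s' t ↔ (rot13 (dtab (D.gsh s t) (D.gsh s' t)) ((D.gof s t + 13 - D.gof s' t) % 13)).testBit i = true := by
  rw [← maskOf_crossDiff_eq D hV h1 h1', testBit_maskOf_val]
end valid
/-! ### the invariant -/
/-- the state describes the placed cells `done` of valid `D`: records, row masks, column masks, cross masks (only bits of realised cross differences) -/
structure PInv (D : LiftData 11 13) (done : List (ℕ × ℕ)) (R C X Q : ℕ) : Prop where
  /-- placed cells are cells, nonempty, and recorded with their translate and shape -/
  qd : ∀ c ∈ done, ∃ (hs : c.1 < 11) (ht : c.2 < 11), 1 ≤ D.om ⟨c.1, hs⟩ ⟨c.2, ht⟩ ∧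
    qget Q (11 * c.1 + c.2) = D.gof ⟨c.1, hs⟩ ⟨c.2, ht⟩ + 1 + 16 * D.gsh ⟨c.1, hs⟩ ⟨c.2, ht⟩
  /-- other records are empty -/
  qf : ∀ s t, s < 11 → t < 11 → (s, t) ∉ done → qget Q (11 * s + t) = 0
  /-- row mask bits come from placed cells of the row -/
  row : ∀ (s : ℕ) (hs : s < 11) (i : ℕ) (hi : i < 13), (fld R s).testBit i = true → ∃ (t : ℕ) (ht : t < 11), (s, t) ∈ done ∧ D.mem ⟨s, hs⟩ ⟨t, ht⟩ ⟨i, hi⟩ = true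
  /-- column mask bits come from placed cells of the column -/
  col : ∀ (t : ℕ) (ht : t < 11) (i : ℕ) (hi : i < 13), (fld C t).testBit i = true → ∃ (s : ℕ) (hs : s < 11), (s, t) ∈ done ∧ D.mem ⟨s, hs⟩ ⟨t, ht⟩ ⟨i, hi⟩ = true
  /-- cross mask bits of a pair `s < s'` come from columns where both cells are placed -/
  cross : ∀ (s s' : ℕ) (hs : s < 11) (hs' : s' < 11), s < s' → ∀ (i : ℕ) (hi : i < 13), (fld X (11 * s + s')).testBit i = true →
    ∃ (t : ℕ) (ht : t < 11), (s, t) ∈ done ∧ (s', t) ∈ done ∧ (⟨i, hi⟩ : Fin 13) ∈ D.crossDiff ⟨s, hs⟩ ⟨s', hs'⟩ ⟨t, ht⟩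
/-- the empty state -/
theorem pinv_nil (D : LiftData 11 13) : PInv D [] 0 0 0 0 where
  qd := fun c hc => absurd hc (by simp)
  qf := fun s t _ _ _ => by apply Nat.eq_of_testBit_eq; intro j; rw [testBit_qget]; simp
  row := fun s hs i hi h => by rw [testBit_fld] at h; simp at h
  col := fun t ht i hi h => by rw [testBit_fld] at h; simp at h
  cross := fun s s' hs hs' _ i hi h => by rw [testBit_fld] at h; simp at h
section step
variable {D : LiftData 11 13} (hV : D.Valid)
include hV
/-- **the mates loop on the true translate succeeds**, and its result records exactly the new column's cross differences for the pairs through row `s`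
(loop invariant over the rows `s' < n` examined so far) -/
theorem mates_true {done : List (ℕ × ℕ)} {R C X Q : ℕ} (hI : PInv D done R C X Q) {s t : ℕ} (hs : s < 11) (ht : t < 11) (hnot : (s, t) ∉ done)
    (h1 : 1 ≤ D.om ⟨s, hs⟩ ⟨t, ht⟩) :
    ∀ n ≤ 11, ∃ Xn, mates Q X s t (D.gsh ⟨s, hs⟩ ⟨t, ht⟩) (D.gof ⟨s, hs⟩ ⟨t, ht⟩) n = some Xn ∧
      ∀ (a b : ℕ) (ha : a < 11) (hb : b < 11), a < b → ∀ (i : ℕ) (hi : i < 13), (fld Xn (11 * a + b)).testBit i = true →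
        ∃ (t' : ℕ) (ht' : t' < 11), (⟨i, hi⟩ : Fin 13) ∈ D.crossDiff ⟨a, ha⟩ ⟨b, hb⟩ ⟨t', ht'⟩ ∧
          (((a, t') ∈ done ∧ (b, t') ∈ done) ∨ (t' = t ∧ ((a = s ∧ (b, t) ∈ done ∧ b < n) ∨ (b = s ∧ (a, t) ∈ done ∧ a < n))))
  | 0, _ => ⟨X, rfl, fun a b ha hb hab i hi h => by
      obtain ⟨t', ht', ha', hb', hm⟩ := hI.cross a b ha hb hab i hi h
      exact ⟨t', ht', hm, Or.inl ⟨ha', hb'⟩⟩⟩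
  | n + 1, hn => by
    obtain ⟨Xn, hXn, hinv⟩ := mates_true hI hs ht hnot h1 n (by omega)
    rw [mates, hXn]
    simp only
    -- weaken the invariant to `n + 1`
    have hinv' : ∀ (a b : ℕ) (ha : a < 11) (hb : b < 11), a < b → ∀ (i : ℕ) (hi : i < 13), (fld Xn (11 * a + b)).testBit i = true →
        ∃ (t' : ℕ) (ht' : t' < 11), (⟨i, hi⟩ : Fin 13) ∈ D.crossDiff ⟨a, ha⟩ ⟨b, hb⟩ ⟨t', ht'⟩ ∧
          (((a, t') ∈ done ∧ (b, t') ∈ done) ∨ (t' = t ∧ ((a = s ∧ (b, t) ∈ done ∧ b < n + 1) ∨ (b = s ∧ (a, t) ∈ done ∧ a < n + 1)))) := by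
      intro a b ha hb hab i hi h
      obtain ⟨t', ht', hm, hc⟩ := hinv a b ha hb hab i hi h
      refine ⟨t', ht', hm, ?_⟩
      rcases hc with hc | ⟨e, hc⟩
      · exact Or.inl hc
      · right; refine ⟨e, ?_⟩
        rcases hc with ⟨e1, h2, h3⟩ | ⟨e1, h2, h3⟩
        · exact Or.inl ⟨e1, h2, by omega⟩
        · exact Or.inr ⟨e1, h2, by omega⟩
    by_cases hns : n = s
    · rw [show Nat.beq n s = true by rw [Shape13.beq_eq_decide]; exact decide_eq_true hns]
      exact ⟨Xn, rfl, hinv'⟩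
    rw [show Nat.beq n s = false by rw [Shape13.beq_eq_decide]; exact decide_eq_false hns]
    simp only [cond_false]
    have hn11 : n < 11 := by omega
    by_cases hmem : (n, t) ∈ done
    · -- a placed mate: read its record, the check passes, and the new bits are the cross differences of column `t`
      obtain ⟨hs', ht', h1', hq⟩ := hI.qd (n, t) hmem
      dsimp only at hs' ht' h1' hq
      have hq0 : Nat.beq (qget Q (11 * n + t)) 0 = false := by
        rw [Shape13.beq_eq_decide]; exact decide_eq_false (by rw [hq]; omega)
      rw [hq0]
      simp only [cond_false]
      have hg27 := (D.shape_spec hV h1').1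
      have hx13 := (D.shape_spec hV h1').2.1
      have ex : Nat.land (qget Q (11 * n + t)) 15 - 1 = D.gof ⟨n, hn11⟩ ⟨t, ht⟩ := by
        rw [hq, Shape13.land_def, show (15 : ℕ) = 2 ^ 4 - 1 from rfl, Nat.and_two_pow_sub_one_eq_mod, show (2 : ℕ) ^ 4 = 16 by norm_num]; omega
      have eg : Nat.shiftRight (qget Q (11 * n + t)) 4 = D.gsh ⟨n, hn11⟩ ⟨t, ht⟩ := by
        rw [hq, Shape13.shiftRight_def, Nat.shiftRight_eq_div_pow, show (2 : ℕ) ^ 4 = 16 by norm_num]; omega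
      rw [ex, eg]
      rcases Nat.lt_or_gt_of_ne (Ne.symm hns) with hlt | hgt
      · -- s < n: pair (s, n), differences cell(s,t) − cell(n,t)
        have hb1 : Nat.blt s n = true := by rw [Shape13.blt_eq_decide]; exact decide_eq_true hlt
        rw [hb1]
        simp only [cond_true]
        set Dm := rot13 (dtab (D.gsh ⟨s, hs⟩ ⟨t, ht⟩) (D.gsh ⟨n, hn11⟩ ⟨t, ht⟩)) ((D.gof ⟨s, hs⟩ ⟨t, ht⟩ + 13 - D.gof ⟨n, hn11⟩ ⟨t, ht⟩) % 13) with hDm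
        have hchk : Nat.beq (Nat.land Dm (fld Xn (11 * s + n))) 0 = true := by
          rw [Shape13.beq_eq_decide, decide_eq_true_eq]
          refine land_eq_zero_of fun j hj hX => ?_
          have hj13 : j < 13 := by
            by_contra hj'
            rw [hDm, testBit_eq_false_of_lt_le (rot13_lt _ _) (not_lt.1 hj')] at hj; exact Bool.false_ne_true hj
          have hmem1 : (⟨j, hj13⟩ : Fin 13) ∈ D.crossDiff ⟨s, hs⟩ ⟨n, hn11⟩ ⟨t, ht⟩ := (mem_crossDiff_iff_testBit D hV h1 h1' _).2 hj
          obtain ⟨t', ht', hm', hc⟩ := hinv s n hs hn11 hlt j hj13 hX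
          have htt : t' ≠ t := by
            rintro rfl
            rcases hc with ⟨h1x, -⟩ | ⟨-, hc⟩
            · exact hnot h1x
            · rcases hc with ⟨-, -, h3⟩ | ⟨e, -, -⟩ <;> omega
          exact Finset.disjoint_left.1 (D.crossDiff_disjoint hV (s := ⟨s, hs⟩) (s' := ⟨n, hn11⟩) (by intro e; simp at e; omega)
            (t := ⟨t, ht⟩) (t' := ⟨t', ht'⟩) (by intro e; simp at e; omega)) hmem1 hm'
        rw [hchk]
        refine ⟨_, rfl, fun a b ha hb hab i hi h => ?_⟩
        rw [testBit_fld_lor (rot13_lt _ _) hi] at h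
        rcases Bool.or_eq_true_iff.1 h with h | h
        · exact hinv' a b ha hb hab i hi h
        · simp only [Bool.and_eq_true, decide_eq_true_eq] at h
          obtain ⟨hp, hbit⟩ := h
          have ea : a = s := by omega
          have eb : b = n := by omega
          subst ea; subst eb
          exact ⟨t, ht, (mem_crossDiff_iff_testBit D hV h1 h1' ⟨i, hi⟩).2 hbit, Or.inr ⟨rfl, Or.inl ⟨rfl, hmem, by omega⟩⟩⟩
      · -- n < s: pair (n, s), differences cell(n,t) − cell(s,t)
        have hb1 : Nat.blt s n = false := by rw [Shape13.blt_eq_decide]; exact decide_eq_false (by omega)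
        rw [hb1]
        simp only [cond_false]
        set Dm := rot13 (dtab (D.gsh ⟨n, hn11⟩ ⟨t, ht⟩) (D.gsh ⟨s, hs⟩ ⟨t, ht⟩)) ((D.gof ⟨n, hn11⟩ ⟨t, ht⟩ + 13 - D.gof ⟨s, hs⟩ ⟨t, ht⟩) % 13) with hDm
        have hchk : Nat.beq (Nat.land Dm (fld Xn (11 * n + s))) 0 = true := by
          rw [Shape13.beq_eq_decide, decide_eq_true_eq]
          refine land_eq_zero_of fun j hj hX => ?_
          have hj13 : j < 13 := by
            by_contra hj'
            rw [hDm, testBit_eq_false_of_lt_le (rot13_lt _ _) (not_lt.1 hj')] at hj; exact Bool.false_ne_true hj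
          have hmem1 : (⟨j, hj13⟩ : Fin 13) ∈ D.crossDiff ⟨n, hn11⟩ ⟨s, hs⟩ ⟨t, ht⟩ := (mem_crossDiff_iff_testBit D hV h1' h1 _).2 hj
          obtain ⟨t', ht', hm', hc⟩ := hinv n s hn11 hs hgt j hj13 hX
          have htt : t' ≠ t := by
            rintro rfl
            rcases hc with ⟨-, h2x⟩ | ⟨-, hc⟩
            · exact hnot h2x
            · rcases hc with ⟨e, -, -⟩ | ⟨-, -, h3⟩ <;> omega
          exact Finset.disjoint_left.1 (D.crossDiff_disjoint hV (s := ⟨n, hn11⟩) (s' := ⟨s, hs⟩) (by intro e; simp at e; omega)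
            (t := ⟨t, ht⟩) (t' := ⟨t', ht'⟩) (by intro e; simp at e; omega)) hmem1 hm'
        rw [hchk]
        refine ⟨_, rfl, fun a b ha hb hab i hi h => ?_⟩
        rw [testBit_fld_lor (rot13_lt _ _) hi] at h
        rcases Bool.or_eq_true_iff.1 h with h | h
        · exact hinv' a b ha hb hab i hi h
        · simp only [Bool.and_eq_true, decide_eq_true_eq] at h
          obtain ⟨hp, hbit⟩ := h
          have ea : a = n := by omega
          have eb : b = s := by omega
          subst ea; subst eb
          exact ⟨t, ht, (mem_crossDiff_iff_testBit D hV h1' h1 ⟨i, hi⟩).2 hbit, Or.inr ⟨rfl, Or.inr ⟨rfl, hmem, by omega⟩⟩⟩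
    · -- no mate in row n
      rw [show Nat.beq (qget Q (11 * n + t)) 0 = true by rw [hI.qf n t hn11 ht hmem]; rfl]
      exact ⟨Xn, rfl, hinv'⟩
omit hV in
/-- `cands` over `x < n` containing the true translate `x₀`: its conjunct holds -/
theorem cands_true {k : ℕ → ℕ → ℕ → ℕ → Bool} {s t g R C X Q x₀ : ℕ} :
    ∀ {n : ℕ}, cands k s t g R C X Q n = true → x₀ < n →
      (let cm := rot13 (shm g) x₀
       bif bit cm 0 || !(Nat.beq (Nat.land cm (fld R s)) 0) || !(Nat.beq (Nat.land cm (fld C t)) 0) then true else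
         match mates Q X s t g x₀ 11 with
         | none => true
         | some X' => k (Nat.lor R (Nat.shiftLeft cm (13 * s))) (Nat.lor C (Nat.shiftLeft cm (13 * t))) X'
             (Nat.lor Q (Nat.shiftLeft (x₀ + 1 + 16 * g) (9 * (11 * s + t))))) = true
  | 0, _, h => absurd h (by omega)
  | n + 1, h, hx => by
    rw [cands, Bool.and_eq_true] at h
    rcases Nat.lt_succ_iff_lt_or_eq.1 hx with hx | rfl
    · exact cands_true h.2 hx
    · exact h.1
/-- **SOUNDNESS OF THE PLACEMENT SEARCH**: along the invariant, with the remaining cells distinct, new, nonempty and of the listed shapes, `placeK = true` is impossible -/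
theorem placeK_sound : ∀ (cells : List (ℕ × ℕ × ℕ)) (done : List (ℕ × ℕ)) (R C X Q : ℕ), PInv D done R C X Q →
    (cells.map fun c => (c.1, c.2.1)).Nodup → (∀ c ∈ cells, (c.1, c.2.1) ∉ done) →
    (∀ c ∈ cells, ∃ (hs : c.1 < 11) (ht : c.2.1 < 11), 1 ≤ D.om ⟨c.1, hs⟩ ⟨c.2.1, ht⟩ ∧ D.gsh ⟨c.1, hs⟩ ⟨c.2.1, ht⟩ = c.2.2) →
    placeK cells R C X Q = true → False
  | [], _, _, _, _, _, _, _, _, _, h => Bool.false_ne_true h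
  | (s, t, g) :: rest, done, R, C, X, Q, hI, hnd, hnew, hcells, h => by
    obtain ⟨hs, ht, h1, hg⟩ := hcells (s, t, g) (List.mem_cons_self ..)
    dsimp only at hs ht h1 hg
    have hnot : (s, t) ∉ done := hnew (s, t, g) (List.mem_cons_self ..)
    rw [placeK] at h
    dsimp only at h
    have hx13 := (D.shape_spec hV h1).2.1
    have hg27 := (D.shape_spec hV h1).1
    have hc := cands_true (x₀ := D.gof ⟨s, hs⟩ ⟨t, ht⟩) h hx13
    subst hg
    simp only at hc
    -- the three quick tests pass on the true translate
    have hb0 : bit (rot13 (shm (D.gsh ⟨s, hs⟩ ⟨t, ht⟩)) (D.gof ⟨s, hs⟩ ⟨t, ht⟩)) 0 = false := by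
      rw [bit_eq, show (0 : ℕ) = ((0 : Fin 13) : ℕ) from rfl, testBit_cell D hV h1]; exact (hV.1 ⟨s, hs⟩).1.1 ⟨t, ht⟩
    have hR : Nat.beq (Nat.land (rot13 (shm (D.gsh ⟨s, hs⟩ ⟨t, ht⟩)) (D.gof ⟨s, hs⟩ ⟨t, ht⟩)) (fld R s)) 0 = true := by
      rw [Shape13.beq_eq_decide, decide_eq_true_eq]
      refine land_eq_zero_of fun j hj hRj => ?_
      have hj13 : j < 13 := by
        by_contra hj'; rw [testBit_eq_false_of_lt_le (rot13_lt _ _) (not_lt.1 hj')] at hj; exact Bool.false_ne_true hj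
      have hm : D.mem ⟨s, hs⟩ ⟨t, ht⟩ ⟨j, hj13⟩ = true := by rw [← testBit_cell D hV h1 ⟨j, hj13⟩]; exact hj
      obtain ⟨t', ht', hmem', hm'⟩ := hI.row s hs j hj13 hRj
      have htt : (⟨t, ht⟩ : Fin 11) ≠ ⟨t', ht'⟩ := by intro e; simp at e; subst e; exact hnot hmem'
      exact Finset.disjoint_left.1 (D.cell_disjoint_row (hV.1 ⟨s, hs⟩).1 htt) (by rw [mem_cell]; exact hm) (by rw [mem_cell]; exact hm')
    have hCt : Nat.beq (Nat.land (rot13 (shm (D.gsh ⟨s, hs⟩ ⟨t, ht⟩)) (D.gof ⟨s, hs⟩ ⟨t, ht⟩)) (fld C t)) 0 = true := by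
      rw [Shape13.beq_eq_decide, decide_eq_true_eq]
      refine land_eq_zero_of fun j hj hCj => ?_
      have hj13 : j < 13 := by
        by_contra hj'; rw [testBit_eq_false_of_lt_le (rot13_lt _ _) (not_lt.1 hj')] at hj; exact Bool.false_ne_true hj
      have hm : D.mem ⟨s, hs⟩ ⟨t, ht⟩ ⟨j, hj13⟩ = true := by rw [← testBit_cell D hV h1 ⟨j, hj13⟩]; exact hj
      obtain ⟨s', hs', hmem', hm'⟩ := hI.col t ht j hj13 hCj
      have hss : (⟨s, hs⟩ : Fin 11) ≠ ⟨s', hs'⟩ := by intro e; simp at e; subst e; exact hnot hmem'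
      exact (hV.2 ⟨s, hs⟩ ⟨s', hs'⟩ hss).1 ⟨t, ht⟩ ⟨j, hj13⟩ ⟨hm, hm'⟩
    rw [hb0, hR, hCt] at hc
    simp only [Bool.not_true, Bool.or_false, cond_false] at hc
    -- the mates loop
    obtain ⟨X', hX', hXinv⟩ := mates_true hV hI hs ht hnot h1 11 le_rfl
    rw [hX'] at hc
    simp only at hc
    -- the new state satisfies the invariant for `(s, t) :: done`
    refine placeK_sound rest ((s, t) :: done) _ _ _ _ ?_ (List.nodup_cons.1 hnd).2 ?_ (fun c hc' => hcells c (List.mem_cons_of_mem _ hc')) hc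
    · have hv9 : D.gof ⟨s, hs⟩ ⟨t, ht⟩ + 1 + 16 * D.gsh ⟨s, hs⟩ ⟨t, ht⟩ < 512 := by omega
      exact {
        qd := by
          intro c hc'
          rcases List.mem_cons.1 hc' with rfl | hc'
          · exact ⟨hs, ht, h1, qget_lor_self hv9 (hI.qf s t hs ht hnot)⟩
          · obtain ⟨hs', ht', h1', hq⟩ := hI.qd c hc'
            have hne : 11 * c.1 + c.2 ≠ 11 * s + t := by
              intro e; apply hnot
              have e1 : c.1 = s := by omega
              have e2 : c.2 = t := by omega
              have : c = (s, t) := Prod.ext e1 e2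
              rw [← this]; exact hc'
            exact ⟨hs', ht', h1', by rw [qget_lor_of_ne hv9 hne, hq]⟩
        qf := by
          intro s' t' hs' ht' hmem
          rw [List.mem_cons, not_or] at hmem
          rw [qget_lor_of_ne hv9 (by intro e; apply hmem.1; simp only [Prod.mk.injEq]; omega), hI.qf s' t' hs' ht' hmem.2]
        row := by
          intro s' hs' i hi h
          rw [testBit_fld_lor (rot13_lt _ _) hi] at h
          rcases Bool.or_eq_true_iff.1 h with h | h
          · obtain ⟨t', ht', hm, hb⟩ := hI.row s' hs' i hi h
            exact ⟨t', ht', List.mem_cons_of_mem _ hm, hb⟩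
          · simp only [Bool.and_eq_true, decide_eq_true_eq] at h
            obtain ⟨rfl, hb⟩ := h
            exact ⟨t, ht, List.mem_cons_self .., by rw [← testBit_cell D hV h1 ⟨i, hi⟩]; exact hb⟩
        col := by
          intro t' ht' i hi h
          rw [testBit_fld_lor (rot13_lt _ _) hi] at h
          rcases Bool.or_eq_true_iff.1 h with h | h
          · obtain ⟨s', hs', hm, hb⟩ := hI.col t' ht' i hi h
            exact ⟨s', hs', List.mem_cons_of_mem _ hm, hb⟩
          · simp only [Bool.and_eq_true, decide_eq_true_eq] at h
            obtain ⟨rfl, hb⟩ := h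
            exact ⟨s, hs, List.mem_cons_self .., by rw [← testBit_cell D hV h1 ⟨i, hi⟩]; exact hb⟩
        cross := by
          intro a b ha hb hab i hi h
          obtain ⟨t', ht', hm, hc⟩ := hXinv a b ha hb hab i hi h
          refine ⟨t', ht', ?_, ?_, hm⟩
          · rcases hc with ⟨h1a, -⟩ | ⟨rfl, hc⟩
            · exact List.mem_cons_of_mem _ h1a
            · rcases hc with ⟨rfl, -, -⟩ | ⟨-, h2, -⟩
              · exact List.mem_cons_self ..
              · exact List.mem_cons_of_mem _ h2
          · rcases hc with ⟨-, h1b⟩ | ⟨rfl, hc⟩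
            · exact List.mem_cons_of_mem _ h1b
            · rcases hc with ⟨-, h2, -⟩ | ⟨rfl, -, -⟩
              · exact List.mem_cons_of_mem _ h2
              · exact List.mem_cons_self .. }
    · intro c hc' hmem
      rcases List.mem_cons.1 hmem with e | hmem
      · have : (c.1, c.2.1) ∈ (rest.map fun c => (c.1, c.2.1)) := List.mem_map.2 ⟨c, hc', rfl⟩
        rw [e] at this
        exact (List.nodup_cons.1 hnd).1 this
      · exact hnew c (List.mem_cons_of_mem _ hc') hmem
end step
/-- the cell coordinates of a list are pairwise distinct (decidable reading) -/
def cellsNodup (cells : List (ℕ × ℕ × ℕ)) : Bool := (cells.map fun c => 11 * c.1 + c.2.1).Nodup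
/-- **NO PLACEMENT ⇒ NO SUCH DATA**: if the search refutes the listed cells from the empty state, no valid `D` has these nonempty cells with these shapes -/
theorem noPlace {cells : List (ℕ × ℕ × ℕ)} (hrun : placeK cells 0 0 0 0 = true) (hnd : (cells.map fun c => (c.1, c.2.1)).Nodup)
    (D : LiftData 11 13) (hV : D.Valid)
    (hcells : ∀ c ∈ cells, ∃ (hs : c.1 < 11) (ht : c.2.1 < 11), 1 ≤ D.om ⟨c.1, hs⟩ ⟨c.2.1, ht⟩ ∧ D.gsh ⟨c.1, hs⟩ ⟨c.2.1, ht⟩ = c.2.2) : False :=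
  placeK_sound hV cells [] 0 0 0 0 (pinv_nil D) hnd (fun _ _ h => by simp at h) hcells hrun
end Place13
end Summit.Ventures.DiscreteObjects.PP12
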